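import Mathlib
import HarnessLib
import Literature.Combinatorics.Additive.Pollard
import Literature.Combinatorics.Additive.Kneser
import Literature.Combinatorics.Additive.GrynkiewiczPollardRep
import Literature.Combinatorics.Additive.GrynkiewiczPollardKneserTools
import Literature.Combinatorics.Additive.GrynkiewiczPollardStepOne
import Literature.Combinatorics.Additive.GrynkiewiczPollardStepTwo
import Literature.Combinatorics.Additive.GrynkiewiczPollardDyson
import Literature.Combinatorics.Additive.GrynkiewiczPollardStepThree
import Literature.Combinatorics.Additive.PollardFourThirdsDysonPair

/-!
# Pollard's theorem in general abelian groups with the constant `−(4/3)t²` (Grynkiewicz–Wang 2026) — II: small translates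

Topic: `Literature/Combinatorics/Additive`.  Second file of the port of D. J. Grynkiewicz, R. Wang,
*Pollard's theorem in general abelian groups*, arXiv:2601.17922 (2026), **Theorem 1.8** (see
`PollardFourThirdsDysonPair.lean` for the statement and the architecture).

This file redoes STEP 3 of the tree's port of [Gry10] (`Grynkiewicz.step_three_ge3`, the only place of that
port needing `c ≥ 2t² − 1`) for the constant `c_t = ⌊(4t² − 2t)/3⌋`: the situation where every translate
`z + B` not contained in `A` meets `A` in at most `t − 1` points («Claim 5» of the source, `|B(0)| ≥ t`, is
the statement that this situation is contradictory).  Ingredients, all from §2 of the source: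

* the dot-diagram identities `(holes)` `N_t + |X|·|B| ≥ |A||B| + t|X|` and `N_t = t|X| + |E|`, where
  `X = A +_{t+1} B` and `E = {(a,b) ∈ A × B : a + b ∉ X}` is the edge set of the graph `Γ_t`
  (`holes_ineq`, `NS_eq_mul_card_add_card_edges`);
* «Claim 3»: `|B| ≥ 2t − 1` (`claim3_arith`, from `(holes)`, «Claim 1» — the theorem for `t − 1`, entering
  as the hypothesis `(t−1)(|A|+|B|) ≤ N_{t−1}(A,B) + c′` — and `N_{t−1} + |A +_t B| = N_t`);
* the bound `|T| ≤ |A| − |B| + t − 1` for the set `T` of translates of `B` inside `A` (Kneser's theorem and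
  the coset trap; this is verbatim the `key` step of `Grynkiewicz.step_three_ge3`, isolated here as
  `goal_or_card_translates_le`);
* the minimum degree `s` of a vertex `b ∈ B` of `Γ_t`, the counts `|E| ≥ s|B|`,
  `|X| ≥ (|A| − s) + (|B| − 2t + 2)` and the final estimate `N_t ≥ t|A| + t|B| − 2t² + 2t + s(|B| − t)` with
  `3s > 2t` (`claim5_arith`).

Deviations from the printed text (flagged): (i) no translation `b₀ ↦ 0` is performed — the vertex `b₀` of
minimum degree is carried explicitly, `A + b₀` playing the role of `A ⊆ A + B`; (ii) the displayed count
(AtBlower) with `t` translates `x_1, …, x_t` is replaced by the single-translate count the source itself uses two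
lines later (`|X ∖ A| ≥ |(x_i + B) ∩ (X ∖ A)| ≥ |B| − 2t + 2`), which gives the same inequality (green);
(iii) «Claim 2» and «Claim 4» are used in the tree's form (`Grynkiewicz.goal_of_row/col`,
`Grynkiewicz.goal_of_subset_coset`: an unpopular row/column, resp. a coset trap, already yields `Goal`).

## References
* D. J. Grynkiewicz, R. Wang, arXiv:2601.17922 (2026), §2: (holes), Claims 3–5
  [cite: GrynkiewiczWang2026, Thm 1.8].
* D. J. Grynkiewicz, Israel J. Math. 177 (2010) 413–439, §2 Case 3.2 [cite: Grynkiewicz2010, Thm 1.1].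
-/

namespace Literature.Combinatorics.Additive

namespace GrynkiewiczWang

open Finset Pollard Grynkiewicz
open scoped Pointwise

variable {G : Type*} [AddCommGroup G] [DecidableEq G]

/-! ### The dot diagram: `X = A +_{t+1} B` and the edge set of `Γ_t` -/

section Dots

variable {t : ℕ} {A B : Finset G}

/-- `(holes)`: `|A||B| + t|X| ≤ N_t(A,B) + |X|·|B|` for `X = A +_{t+1} B` (the `|X| × (|B| − t)` rectangle of the
dot diagram has `y ≥ 0` holes). [cite: GrynkiewiczWang2026, §2 (holes)] -/
theorem holes_ineq (t : ℕ) (A B : Finset G) :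
    A.card * B.card + t * ((A + B).filter (fun w => t < rep A B w)).card ≤
      NS t A B + ((A + B).filter (fun w => t < rep A B w)).card * B.card := by
  have h := NS_add_sum_popular t A B
  have h2 : ∑ w ∈ (A + B).filter (fun w => t < rep A B w), rep A B w ≤
      ((A + B).filter (fun w => t < rep A B w)).card * B.card := by
    have := Finset.sum_le_card_nsmul ((A + B).filter (fun w => t < rep A B w)) (fun w => rep A B w) B.card
      (fun w _ => rep_le_card_right A B w)
    rwa [smul_eq_mul] at this
  omega

/-- `N_t(A,B) = t|X| + |E|` with `E = {(a,b) ∈ A × B : a + b ∉ X}` the edge set of `Γ_t`.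
[cite: GrynkiewiczWang2026, §2 (AtBt)] -/
theorem NS_eq_mul_card_add_card_edges (t : ℕ) (A B : Finset G) :
    NS t A B = t * ((A + B).filter (fun w => t < rep A B w)).card +
      ((A ×ˢ B).filter (fun p => p.1 + p.2 ∉ (A + B).filter (fun w => t < rep A B w))).card :=
  NS_eq_of_threshold (filter_subset _ _) (fun _ hw => (mem_filter.1 hw).2.le)
    (fun _ hw hX => not_lt.1 fun h => hX (mem_filter.2 ⟨hw, h⟩))

/-- The edge set of `Γ_t` counted by the vertices of `B`: `|E| = Σ_{b ∈ B} deg(b)` with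
`deg(b) = #{a ∈ A : r(a + b) ≤ t}`. [cite: GrynkiewiczWang2026, §2 (EsB)] -/
theorem card_edges_eq_sum_deg (t : ℕ) (A B : Finset G) :
    ((A ×ˢ B).filter (fun p => p.1 + p.2 ∉ (A + B).filter (fun w => t < rep A B w))).card =
      ∑ b ∈ B, (A.filter (fun a => rep A B (a + b) ≤ t)).card := by
  rw [card_eq_sum_card_fiberwise (f := fun p : G × G => p.2) (t := B)
    (s := (A ×ˢ B).filter (fun p => p.1 + p.2 ∉ (A + B).filter (fun w => t < rep A B w)))
    (fun p hp => (mem_product.1 (mem_filter.1 (mem_coe.1 hp)).1).2)]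
  refine sum_congr rfl fun b hb => ?_
  refine card_bij (fun p _ => p.1) ?_ ?_ ?_
  · intro p hp
    simp only [mem_filter, mem_product] at hp ⊢
    obtain ⟨⟨⟨ha, hb'⟩, hX⟩, rfl⟩ := hp
    exact ⟨ha, not_lt.1 fun h => hX ⟨add_mem_add ha hb', h⟩⟩
  · intro p hp q hq e
    simp only [mem_filter, mem_product] at hp hq
    ext
    · exact e
    · rw [hp.2, hq.2]
  · intro a ha
    rw [mem_filter] at ha
    refine ⟨(a, b), ?_, rfl⟩
    rw [mem_filter, mem_filter, mem_product]
    exact ⟨⟨⟨ha.1, hb⟩, fun h => absurd (mem_filter.1 h).2 (not_lt.2 ha.2)⟩, rfl⟩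

/-- `X = A +_{t+1} B ⊆ A +_t B`, in cardinality. [cite: GrynkiewiczWang2026, §2] -/
theorem card_filter_lt_le_card_filter_le (t : ℕ) (A B : Finset G) :
    ((A + B).filter (fun w => t < rep A B w)).card ≤ ((A + B).filter (fun w => t ≤ rep A B w)).card :=
  card_le_card fun w hw => by rw [mem_filter] at hw ⊢; exact ⟨hw.1, hw.2.le⟩

end Dots

/-! ### The arithmetic of Claims 3 and 5 -/

section Arith

/-- «Claim 3»: if `t + 1 ≤ |B| ≤ 2t − 2` then `(holes)`, «Claim 1» (`(t−1)(|A|+|B|) ≤ N_{t−1} + c′`),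
`N_{t−1} + |A +_t B| = N_t ≥ N_{t−1} + |X|` and `N_t + c < t(|A| + |B|)` are contradictory once
`3c ≥ 4t² − 2t − 2` and `3c′ ≤ 4(t−1)² − 2(t−1)` (the source's `f(u) > 0` on `[1, t−2]`).
[cite: GrynkiewiczWang2026, §2 Claim 3] -/
theorem claim3_arith {t a b X N N' M c c' : ℕ} (ht : 3 ≤ t) (hb1 : t + 1 ≤ b) (hb2 : b + 2 ≤ 2 * t)
    (hholes : a * b + t * X ≤ N + X * b) (h1 : (t - 1) * (a + b) ≤ N' + c') (hNN : N' + M = N)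
    (hXM : X ≤ M) (hc3 : 4 * t * t ≤ 3 * c + 2 * t + 2) (hc' : 3 * c' + 10 * t ≤ 4 * t * t + 6)
    (hP : N + c < t * (a + b)) : False := by
  -- `b = t + u` with `1 ≤ u ≤ t − 2`, `t = u + v + 2`
  obtain ⟨u, rfl⟩ : ∃ u, b = t + u := ⟨b - t, by omega⟩
  obtain ⟨v, rfl⟩ : ∃ v, t = u + v + 2 := ⟨t - u - 2, by omega⟩
  have e0 : u + v + 2 - 1 = u + v + 1 := by omega
  rw [e0] at h1
  -- `X + c + 1 ≤ (a + b) + c'`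
  have hXup : X + c + 1 ≤ a + (u + v + 2 + u) + c' := by nlinarith [h1, hNN, hXM, hP]
  -- multiply by `u`
  have hmul : u * (X + c + 1) ≤ u * (a + (u + v + 2 + u) + c') := Nat.mul_le_mul_left u hXup
  -- `X u + t² + t u ≥ a u + c + 1` from `(holes)` and `hP`
  have hlow : a * u + c + 1 ≤ X * u + (u + v + 2) * (u + v + 2) + (u + v + 2) * u := by
    nlinarith [hholes, hP]
  nlinarith [hmul, hlow, hc3, hc', mul_nonneg (Nat.zero_le u) (Nat.zero_le v)]

/-- «Claim 5», final estimate: with `N_t = t|X| + |E|`, `|E| ≥ s|B|`, `|A| + |B| ≤ |X| + s + 2t − 2`,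
`(t−1)(|A|+|B|) + |X| ≤ N_t + c′` («Claim 1» and `N_{t−1} + |X| ≤ N_t`), `|B| ≥ 2t − 1` («Claim 3»),
`3c ≥ 4t² − 2t − 2`, `3c′ ≤ 4(t−1)² − 2(t−1)`: then `N_t + c ≥ t(|A| + |B|)` (the source: `s > 2t/3` and
`Σ > t|A| + t|B| − (4/3)t² + (4/3)t`). [cite: GrynkiewiczWang2026, §2 Claim 5] -/
theorem claim5_arith {t a b s X N E c c' : ℕ} (ht : 3 ≤ t) (hNS : N = t * X + E) (hE : s * b ≤ E)
    (hX : a + b ≤ X + s + (2 * t - 2)) (hup : (t - 1) * (a + b) + X ≤ N + c') (hb : 2 * t ≤ b + 1)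
    (hc3 : 4 * t * t ≤ 3 * c + 2 * t + 2) (hc' : 3 * c' + 10 * t ≤ 4 * t * t + 6)
    (hP : N + c < t * (a + b)) : False := by
  obtain ⟨r, rfl⟩ : ∃ r, t = r + 1 := ⟨t - 1, by omega⟩
  have e0 : r + 1 - 1 = r := by omega
  have e1 : 2 * (r + 1) - 2 = 2 * r := by omega
  rw [e0] at hup
  rw [e1] at hX
  -- `3 s ≥ 2t + 1`
  have hs : 2 * (r + 1) + 1 ≤ 3 * s := by nlinarith [hup, hP, hX, hc3, hc']
  -- `s b ≥ s (2t − 1)` and `t X ≥ t (a + b) − t s − 2t² + 2t`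
  obtain ⟨b', rfl⟩ : ∃ b', b = 2 * r + 1 + b' := ⟨b - (2 * r + 1), by omega⟩
  have hE' : s * (2 * r + 1) ≤ E := le_trans (Nat.mul_le_mul_left s (by omega)) hE
  have hX' : (r + 1) * (a + (2 * r + 1 + b')) ≤ (r + 1) * X + (r + 1) * s + (r + 1) * (2 * r) :=
    by nlinarith [hX]
  nlinarith [hs, hE', hX', hNS, hP, hc3]

end Arith

/-! ### The translates of `B` inside `A` -/

section Translates

variable {t c : ℕ} {A B : Finset G}

/-- The bound `|T| ≤ |A| − |B| + t − 1` for `T = {z : z + B ⊆ A}` when every translate of `B` not inside `A`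
meets `A` in at most `t − 1` points and `|stab(A)| ≤ t − 1` — or `Goal` by the coset trap («Claim 4»): with
`𝒳 = stab(T + B) = stab(T)`, either `B` lies in one `𝒳`-coset (then so does `A`, forcing `A` to be a coset and
`|stab(A)| ≥ |B|`, or the coset trap applies), or every `𝒳`-coset meets `B` in `≤ t − 1` points and Kneser's
theorem bounds `|T|`.  (Verbatim the `key` step of `Grynkiewicz.step_three_ge3`; the source's (boundT).)
[cite: GrynkiewiczWang2026, §2 Claim 5 (boundT)] -/
theorem goal_or_card_translates_le (ht : 1 ≤ t) (hc : t * t ≤ c) (ih : IH t c A B) (hBA : B.card ≤ A.card)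
    (hB : t + 1 ≤ B.card) (hstab : A.addStab.card < t)
    (hm : ∀ z : G, (A ∩ (z +ᵥ B)).card + 1 ≤ t ∨ z +ᵥ B ⊆ A) :
    Goal t c A B ∨ ((A - B).filter (fun z => z +ᵥ B ⊆ A)).card + B.card + 1 ≤ A.card + t := by
  have hA : t + 1 ≤ A.card := hB.trans hBA
  have hBne : B.Nonempty := card_pos.1 (by omega)
  set T := (A - B).filter (fun z => z +ᵥ B ⊆ A) with hTdef
  have hTB : T + B ⊆ A := translates_add_subset
  rcases T.eq_empty_or_nonempty with hT0 | hTne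
  · right; rw [hT0, card_empty]; omega
  set H := (T + B).addStab with hH
  have hTBne : (T + B).Nonempty := hTne.add hBne
  have hper : T + B + H = T + B := add_addStab _
  -- (a) is `B` inside one `H`-coset?
  by_cases hBc : ∃ b₀ ∈ B, B ⊆ b₀ +ᵥ H
  · obtain ⟨b₀, -, hBsub⟩ := hBc
    by_cases hAc : ∃ a₀ ∈ A, A ⊆ a₀ +ᵥ H
    · exfalso
      obtain ⟨a₀, -, hAsub⟩ := hAc
      obtain ⟨w, hw⟩ := hTBne
      have hwA : w ∈ A := hTB hw
      have hcos : w +ᵥ H ⊆ T + B := coset_subset_of_periodic hper hw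
      have hAcos : A ⊆ w +ᵥ H := by rw [coset_eq_of_mem (hAsub hwA)]; exact hAsub
      have hTBA : T + B = A := Subset.antisymm hTB (hAcos.trans hcos)
      have hHA : H = A.addStab := by rw [hH, hTBA]
      have h1 : B.card ≤ H.card := (card_le_card hBsub).trans (card_vadd_finset _ _).le
      rw [hHA] at h1
      omega
    · push Not at hAc
      exact Or.inl (goal_of_subset_coset ht hc ih hA hB hBsub hAc)
  push Not at hBc
  -- (b) every `H`-coset meets `B` in at most `t - 1` points
  have hqubal : ∀ b ∈ B, (B ∩ (b +ᵥ H)).card + 1 ≤ t := by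
    intro b hb
    by_contra hcon
    rw [not_le] at hcon
    obtain ⟨b', hb', hb'c⟩ := not_subset.1 (hBc b hb)
    apply hb'c
    rw [mem_coset_iff]
    refine addStab_subset_addStab_add hBne (mem_addStab_of_forall_add_mem hTne fun z hz => ?_)
    rw [mem_translates_iff hBne]
    rcases hm (b' - b + z) with hsmall | hbig
    · exfalso
      have hsub : (b' - b + z) +ᵥ (B ∩ (b +ᵥ H)) ⊆ A ∩ ((b' - b + z) +ᵥ B) := by
        intro x hx
        obtain ⟨b'', hb'', rfl⟩ := mem_vadd_finset.1 hx
        rw [mem_inter, mem_coset_iff] at hb''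
        refine mem_inter.2 ⟨?_, mem_vadd_finset.2 ⟨b'', hb''.1, rfl⟩⟩
        have e : (b' - b + z) +ᵥ b'' = (z + b') + (b'' - b) := by rw [vadd_eq_add]; abel
        rw [e]
        apply hTB
        rw [← hper]
        exact add_mem_add (add_mem_add hz hb') hb''.2
      have := card_le_card hsub
      rw [card_vadd_finset] at this
      omega
    · exact hbig
  -- (c) the bound on `|T|`
  right
  by_contra hcon
  rw [not_le] at hcon
  have hlt : (T + B).card < T.card + B.card := lt_of_le_of_lt (card_le_card hTB) (by omega)
  have htight := kneser_eq_of_card_add_lt hTne hBne hlt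
  rw [← hH] at htight
  obtain ⟨b, hb⟩ := hBne
  have h1 := card_addStab_le_card_inter_coset_add_holes hTBne hb (A := B) (S := T + B)
  rw [← hH] at h1
  have h2 : T.card ≤ (T + H).card := card_le_card_add_right hTBne.addStab
  have h3 := hqubal b hb
  have h4 := card_le_card hTB
  have h5 : B.card ≤ (B + H).card := card_le_card_add_right hTBne.addStab
  omega

end Translates

/-! ### STEP 3 for the constant `⌊(4t² − 2t)/3⌋`: small translates are impossible -/

section SmallTranslates

variable {t c c' : ℕ} {A B : Finset G}

/-- **[GrynkiewiczWang2026] §2, Claims 3–5 (STEP 3 for `c = ⌊(4t²−2t)/3⌋`).**  Let `t ≥ 3`, `t² ≤ c`,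
`3c ≥ 4t² − 2t − 2`, `3c′ ≤ 4(t−1)² − 2(t−1)`, `|A| ≥ |B| ≥ t + 1`, the induction hypothesis hold below `(A,B)`,
and «Claim 1» `(t−1)(|A|+|B|) ≤ N_{t−1}(A,B) + c′` hold.  If every translate `z + B` not contained in `A` meets
`A` in at most `t − 1` points, then `Goal t c A B`.  Proof: `|stab A| ≥ t` or an unpopular row/column give
`Goal` (STEP 2); otherwise «Claim 3» `|B| ≥ 2t − 1`; with `b₀ ∈ B` of minimum degree `s` in `Γ_t` and
`x ∈ A` with `(x − b₀) + B ⊄ A` (which exists by the bound on `|T|`): `|E| ≥ s|B|`,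
`|X| ≥ |X ∩ (A + b₀)| + |(x + B) ∩ X ∖ (A + b₀)| ≥ (|A| − s) + (|B| − 2t + 2)`, and `claim5_arith`.
[cite: GrynkiewiczWang2026, §2 Claims 3–5] -/
theorem small_translates (ht : 3 ≤ t) (hc : t * t ≤ c) (hc3 : 4 * t * t ≤ 3 * c + 2 * t + 2)
    (hc' : 3 * c' + 10 * t ≤ 4 * t * t + 6) (ih : IH t c A B) (hBA : B.card ≤ A.card) (hB : t + 1 ≤ B.card)
    (hm : ∀ z : G, (A ∩ (z +ᵥ B)).card + 1 ≤ t ∨ z +ᵥ B ⊆ A)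
    (h1 : (t - 1) * (A.card + B.card) ≤ NS (t - 1) A B + c') : Goal t c A B := by
  have hA : t + 1 ≤ A.card := hB.trans hBA
  have hAne : A.Nonempty := card_pos.1 (by omega)
  have hBne : B.Nonempty := card_pos.1 (by omega)
  by_cases hstab : t ≤ A.addStab.card
  · exact goal_of_card_addStab_ge (by omega) hc ih hA hB hstab
  rw [not_le] at hstab
  by_cases hP : t * (A.card + B.card) ≤ NS t A B + c
  · exact Or.inl hP
  rw [not_le] at hP
  -- the translates of `B` inside `A`
  rcases goal_or_card_translates_le (by omega) hc ih hBA hB hstab hm with hG | hT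
  · exact hG
  set T := (A - B).filter (fun z => z +ᵥ B ⊆ A) with hTdef
  -- the dot diagram
  set X := (A + B).filter (fun w => t < rep A B w) with hXdef
  have hholes := holes_ineq t A B
  have hNSX := NS_eq_mul_card_add_card_edges t A B
  have hEdeg := card_edges_eq_sum_deg t A B
  rw [← hXdef] at hholes hNSX hEdeg
  have hNN := NS_pred_add (t := t) (by omega) A B
  have hXM := card_filter_lt_le_card_filter_le t A B
  rw [← hXdef] at hXM
  -- Claim 3: `|B| ≥ 2t − 1`
  have hB2 : 2 * t ≤ B.card + 1 := by
    by_contra hcon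
    rw [not_le] at hcon
    exact claim3_arith ht hB (by omega) hholes h1 hNN hXM hc3 hc' hP
  -- the vertex of `B` of minimum degree in `Γ_t`
  obtain ⟨b₀, hb₀, hmin⟩ := exists_min_image B (fun b => (A.filter (fun a => rep A B (a + b) ≤ t)).card) hBne
  set s := (A.filter (fun a => rep A B (a + b₀) ≤ t)).card with hsdef
  -- Claim 2 for the row of `b₀`
  by_cases hrow : t ≤ s
  · exact goal_of_row (by omega) hc ih hA hB hb₀ hrow
  rw [not_le] at hrow
  -- `|E| ≥ s |B|`
  have hEs : s * B.card ≤ ∑ b ∈ B, (A.filter (fun a => rep A B (a + b) ≤ t)).card := by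
    rw [mul_comm, card_eq_sum_ones, sum_mul]
    exact sum_le_sum fun b hb => by rw [one_mul]; exact hmin b hb
  -- an `x ∈ A` with `(x - b₀) + B ⊄ A`
  have hxex : ∃ x ∈ A, ¬ (x - b₀) +ᵥ B ⊆ A := by
    by_contra hcon
    push Not at hcon
    have hinj : Set.InjOn (fun x => x - b₀) ↑A := fun x _ y _ (e : x - b₀ = y - b₀) => sub_left_injective e
    have himg : A.image (fun x => x - b₀) ⊆ T := by
      intro z hz
      obtain ⟨x, hx, rfl⟩ := mem_image.1 hz
      exact (mem_translates_iff hBne).2 (hcon x hx)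
    have := card_le_card himg
    rw [card_image_of_injOn hinj] at this
    omega
  obtain ⟨x, hxA, hxB⟩ := hxex
  -- Claim 2 for the column of `x`
  by_cases hcol : t ≤ (B.filter (fun β => rep A B (x + β) ≤ t)).card
  · exact goal_of_col (by omega) hc ih hA hB hxA hcol
  rw [not_le] at hcol
  exfalso
  -- maximality: `(x - b₀) + B` meets `A` in at most `t - 1` points
  have hxm : (A ∩ ((x - b₀) +ᵥ B)).card + 1 ≤ t := (hm (x - b₀)).resolve_right hxB
  -- `X₁ = X ∩ (A + b₀)` has `|A| − s` elements
  set X₁ := (A.filter (fun a => t < rep A B (a + b₀))).image (· + b₀) with hX₁def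
  have hX₁card : X₁.card + s = A.card := by
    rw [hX₁def, card_image_of_injective _ (add_left_injective b₀), hsdef]
    have := card_filter_add_card_filter_not (s := A) (fun a => t < rep A B (a + b₀))
    have e : A.filter (fun a => ¬ t < rep A B (a + b₀)) = A.filter (fun a => rep A B (a + b₀) ≤ t) :=
      filter_congr fun a _ => not_lt
    rw [e] at this
    exact this
  have hX₁X : X₁ ⊆ X := by
    intro w hw
    obtain ⟨a, ha, rfl⟩ := mem_image.1 hw
    rw [mem_filter] at ha
    exact mem_filter.2 ⟨add_mem_add ha.1 hb₀, ha.2⟩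
  -- `X₂ = (x + B) ∩ X ∖ (A + b₀)` has at least `|B| − 2t + 2` elements
  set X₂ := (B.filter (fun β => t < rep A B (x + β) ∧ x + β - b₀ ∉ A)).image (x + ·) with hX₂def
  have hX₂X : X₂ ⊆ X := by
    intro w hw
    obtain ⟨β, hβ, rfl⟩ := mem_image.1 hw
    rw [mem_filter] at hβ
    exact mem_filter.2 ⟨add_mem_add hxA hβ.1, hβ.2.1⟩
  have hdisj : Disjoint X₁ X₂ := by
    rw [disjoint_left]
    intro w hw1 hw2
    obtain ⟨a, ha, rfl⟩ := mem_image.1 hw1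
    obtain ⟨β, hβ, e⟩ := mem_image.1 hw2
    rw [mem_filter] at ha hβ
    apply hβ.2.2
    have : x + β - b₀ = a := by rw [e]; simp
    rw [this]; exact ha.1
  have hX₂card : B.card ≤ X₂.card + (t - 1) + (t - 1) := by
    rw [hX₂def, card_image_of_injective _ (add_right_injective x)]
    -- the complement inside `B` splits into the unpopular column of `x` and the part landing in `A + b₀`
    have hsplit : B ⊆ B.filter (fun β => t < rep A B (x + β) ∧ x + β - b₀ ∉ A) ∪
        (B.filter (fun β => rep A B (x + β) ≤ t) ∪ B.filter (fun β => x + β - b₀ ∈ A)) := by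
      intro β hβ
      rw [mem_union, mem_union, mem_filter, mem_filter, mem_filter]
      by_cases h1 : t < rep A B (x + β)
      · by_cases h2 : x + β - b₀ ∈ A
        · exact Or.inr (Or.inr ⟨hβ, h2⟩)
        · exact Or.inl ⟨hβ, h1, h2⟩
      · exact Or.inr (Or.inl ⟨hβ, not_lt.1 h1⟩)
    have hinA : (B.filter (fun β => x + β - b₀ ∈ A)).card + 1 ≤ t := by
      have hsub : (B.filter (fun β => x + β - b₀ ∈ A)).image (fun β => x - b₀ + β) ⊆ A ∩ ((x - b₀) +ᵥ B) := by
        intro w hw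
        obtain ⟨β, hβ, rfl⟩ := mem_image.1 hw
        rw [mem_filter] at hβ
        refine mem_inter.2 ⟨?_, mem_vadd_finset.2 ⟨β, hβ.1, rfl⟩⟩
        have e : x - b₀ + β = x + β - b₀ := by abel
        rw [e]; exact hβ.2
      have := card_le_card hsub
      rw [card_image_of_injective _ (add_right_injective (x - b₀))] at this
      omega
    have := (card_le_card hsplit).trans ((card_union_le _ _).trans
      (Nat.add_le_add_left (card_union_le _ _) _))
    omega
  have hXlow : X₁.card + X₂.card ≤ X.card := by
    rw [← card_union_of_disjoint hdisj]
    exact card_le_card (union_subset hX₁X hX₂X)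
  -- the final count
  have hup : (t - 1) * (A.card + B.card) + X.card ≤ NS t A B + c' := by omega
  exact claim5_arith ht hNSX (hEdeg ▸ hEs) (by omega) hup hB2 hc3 hc' hP

end SmallTranslates

end GrynkiewiczWang

end Literature.Combinatorics.Additive
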